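import Summits.CriticalPhenomena.PercolationContinuityZ3.Theorems.PercNearOneGluingNoHeavyConstsClusterSquare
import Summits.CriticalPhenomena.PercolationContinuityZ3.Theorems.PercNearOneGluingNoHeavyConstsTreeCompare
import Literature.Probability.Percolation.ClusterConditionalCovariance
import Literature.Probability.Percolation.TwoClusterGibbsCovariance
import Mathlib.Tactic.Linarith
import HarnessLib

/-!
# The partial cluster-square inequality: `Var(P(b ↮ c | C_a)) ≤ Var(1_{a ↔ b ↔ c})`

builds on p205010 (kernel theorem, internal audit signed; external expert review pending)

PAPER-2 track "percolation constants", part (ii), seat `prim-consts-1`, gen 16 (lane index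
`run/shared/lean/prim/consts/CONSTANTS.md`, row A19; memo `FROM-prim-consts-1-g15-CLUSTER-SQUARE.md` §0(3½), §6(ii)(e), §7).
Support file for the crux `NoHeavyLowerTail` (stmt-CriticalPhenomena-4575; `--supports`).  Theorems only; no sorries.

Notation (finite weighted graph on `V`, `μ = prodBernoulli w`, vertices `a, b, c`): `U = {b ↮ c}`, `k = μ(a ↔ b, a ↔ c)`,
`J = μ(a joined to exactly one of b, c)`, `D_a = {a ↮ b, a ↮ c}`, `C_a` the open cluster of `a`,
`υ(ω) = E[1_U | 𝓕(C_a)](ω)` (`ClusterConditioning.condExpV`: the average of `1_U` over the hybrids "`ω` on the pairs meeting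
`C_a(ω)`, fresh elsewhere"), and `u(ω) = μ{b ↮ c off C_a(ω)}` (`Consts.sepOffCluster`), `T = ∫_{D_a} u² dμ` (`Consts.clusterSquare`,
gen 15).  Recall (gen 15, `…ConstsClusterSquare.lean`): `μ(a|b|c)² ≤ μ(D_a)·T` (kernel) and the CONJECTURE CSQ `T ≤ μ(U)²`
(`Consts.ClusterSquareSplit`) implies the rooted split inequality DUU and the triple-split inequality TS; in variance form
CSQ ⟺ `Var(υ) ≤ J` (`E υ = μ(U)`, `E υ² = T + J`).

THE RESULTS (all PROVED):
* `Consts.integral_condExpV_sq_le` — **`∫ υ² dμ ≤ μ(U)² + k(1 − k)`**, i.e. `Var(P(b↮c | C_a)) ≤ Var(1_{a↔b↔c})`: the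
  exploration of `C_a` (tree `TargetExploration.ttree` with no target, revealing exactly the pairs meeting `C_a`) satisfies the
  transfer hypothesis of `Consts.TreeCompare.Pr2W_treeHK_sub_sq_le` for the down-set `{b ↮ c}` and the up-set `{a↔b, a↔c}` —
  a pair queried by the exploration has an endpoint joined to `a`, and such a pair is pivotal for `{b ↔ c}` only by merging the
  cluster of `a`, containing one of `b, c`, with the cluster of the other, which creates `{a ↔ b ↔ c}`
  (`Consts.transfer_of_reachable`, from `KNSep.reachable_insert_iff`).
* `Consts.clusterSquare_add_real_xor_le_integral_condExpV_sq` — `T + J ≤ ∫ υ² dμ` (on `D_a`, `υ = u` by van den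
  Berg–Häggström–Kahn's description of the hybrid off the cluster, `ClusterConditioning.reachable_hybrid_iff_diff_cutSet`; on the
  event "exactly one of `b, c` in `C_a`", `υ = 1`).
* **`Consts.clusterSquare_le_sq_sub_xor_add`** — THE PARTIAL CLUSTER-SQUARE INEQUALITY
  `T ≤ μ(b↮c)² − J + k(1−k)`; hence (`Consts.sq_real_split_le_of_small_triple`) the rooted split inequality
  **`μ(a|b|c)² ≤ μ(a↮b, a↮c)·μ(b↮c)²` for every triple with `k(1−k) ≤ J`**, i.e. whenever
  `μ(a↔b↔c)·μ(¬ a↔b↔c) ≤ μ(a joined to exactly one of b,c)` — all sparse / subcritical-like regimes; the dense regime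
  (`k → 1`), where CSQ is asymptotically tight, is exactly what remains of the conjecture.
References: N. Gladkov, arXiv:2408.08457v2 (2024), Lemma 3.1, Thm. 3.2, Example 2.5; J. van den Berg, O. Häggström, J. Kahn,
Random Structures Algorithms 29 (2006), §1 p. 8 and Lemma 2.4; G. Kozma, A. Nitzan (2024), Remark after Lemma 4 (one extra edge).
-/

noncomputable section

open Classical

namespace Summit.CriticalPhenomena.PercolationContinuityZ3.Theorems

open MeasureTheory Finset Literature.Probability.LatticeModels Literature.Probability.Percolation
open Literature.Probability.Percolation.DecisionTree Literature.Probability.Percolation.BHK2006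
open Literature.Probability.Percolation.TargetExploration Literature.Probability.Percolation.ClusterConditioning

namespace Consts

section General

variable {V : Type*} [Fintype V]

/-! ### Plumbing: `Finset` configurations versus `Set` configurations -/

/-- Over all pairs, Gladkov's weight of a `Finset` configuration is BHK's product weight of its coercion. [folklore] -/
private theorem wtW_univ_eq_weight_csv (p : Sym2 V → ℝ) (K : Finset (Sym2 V)) :
    wtW Finset.univ p K = weight p (↑K : Set (Sym2 V)) := by
  unfold wtW weight
  refine Finset.prod_congr rfl fun i _ => ?_
  by_cases hi : i ∈ K
  · rw [if_pos hi, if_pos (Finset.mem_coe.2 hi)]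
  · rw [if_neg hi, if_neg (fun h => hi (Finset.mem_coe.1 h))]

/-- A `wtW`-weighted sum over all `Finset` configurations is the `weight`-weighted sum over all `Set` configurations.
[folklore] -/
private theorem sum_powerset_univ_eq_sum_set_csv (p : Sym2 V → ℝ) (Φ : Set (Sym2 V) → ℝ) :
    ∑ K ∈ (Finset.univ : Finset (Sym2 V)).powerset, wtW Finset.univ p K * Φ ↑K =
      ∑ ω : Set (Sym2 V), weight p ω * Φ ω := by
  rw [Finset.powerset_univ]
  exact Fintype.sum_equiv Fintype.finsetEquivSet _ _ fun K => by
    rw [Fintype.finsetEquivSet_apply, wtW_univ_eq_weight_csv]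

omit [Fintype V] in
/-- The inverse of `Fintype.finsetEquivSet` on a coerced `Finset`. [folklore] -/
private theorem finsetEquivSet_symm_coe_csv [Fintype V] (K : Finset (Sym2 V)) :
    (Fintype.finsetEquivSet (α := Sym2 V)).symm (↑K : Set (Sym2 V)) = K :=
  (Fintype.finsetEquivSet (α := Sym2 V)).symm_apply_apply K

/-- The hybrid of coerced `Finset` configurations is the coerced splice along the revealed set of the exploration of the
cluster of `v`. [cite: Gladkov2024, Def. 2.3–2.4] -/
private theorem hybrid_coe_csv (v : V) (K C : Finset (Sym2 V)) :
    hybrid v (↑K : Set (Sym2 V)) ↑C =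
      ↑(splice (revealedAt (Finset.univ : Finset (Sym2 V)) (∅ : Finset V) v K) K C) := by
  simp only [hybrid, finsetEquivSet_symm_coe_csv]

/-- Indicators of equivalent memberships agree. [folklore] -/
private theorem ind_congr_csv {α β : Type*} {X : Set α} {Y : Set β} {x : α} {y : β} (h : x ∈ X ↔ y ∈ Y) :
    ind X x = ind Y y := by
  by_cases hx : x ∈ X
  · rw [ind_of_mem hx, ind_of_mem (h.1 hx)]
  · rw [ind_of_not_mem hx, ind_of_not_mem (fun hy => hx (h.2 hy))]

/-- `PrW` of the `Finset` version of a `Set`-event is its `weight`-sum. [folklore] -/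
private theorem PrW_univ_eq_sum_weight (p : Sym2 V → ℝ) (X : Set (Set (Sym2 V))) :
    PrW Finset.univ p {K : Finset (Sym2 V) | (↑K : Set (Sym2 V)) ∈ X} = ∑ ω : Set (Sym2 V), weight p ω * ind X ω := by
  rw [PrW_eq_sum_ind, ← sum_powerset_univ_eq_sum_set_csv]
  refine Finset.sum_congr rfl fun K _ => ?_
  rw [ind_congr_csv (X := {K : Finset (Sym2 V) | (↑K : Set (Sym2 V)) ∈ X}) (Y := X) (y := (↑K : Set (Sym2 V)))
    (by simp only [Set.mem_setOf_eq])]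

/-- **The two-configuration probability of the exploration tree is `E[1_X · E[1_X | 𝓕(C_a)]]`**:
`P(C₁ ∈ X, C₁ →_{S(C₁)} C₂ ∈ X) = Σ_ω weight(ω) 1_X(ω) υ_X(ω)` for the tree exploring the whole cluster of `a`.
[cite: Gladkov2024, Lemma 3.1 and Example 2.5] -/
private theorem Pr2W_treeHK_explore_eq (p : Sym2 V → ℝ) (a : V) (X : Set (Set (Sym2 V))) :
    Pr2W Finset.univ p (treeHK ∅ (ttree (Finset.univ : Finset (Sym2 V)) (∅ : Finset V)
        ((Finset.univ : Finset (Sym2 V)).card + 1) (TargetExploration.init a))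
        {K : Finset (Sym2 V) | (↑K : Set (Sym2 V)) ∈ X} {K : Finset (Sym2 V) | (↑K : Set (Sym2 V)) ∈ X}) =
      ∑ ω : Set (Sym2 V), weight p ω * (ind X ω * condExpV p a (ind X) ω) := by
  set X' : Set (Finset (Sym2 V)) := {K | (↑K : Set (Sym2 V)) ∈ X} with hX'
  have hset : treeHK ∅ (ttree (Finset.univ : Finset (Sym2 V)) (∅ : Finset V)
      ((Finset.univ : Finset (Sym2 V)).card + 1) (TargetExploration.init a)) X' X' =
      {c : Finset (Sym2 V) × Finset (Sym2 V) | c.1 ∈ X' ∧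
        splice (revealedAt (Finset.univ : Finset (Sym2 V)) (∅ : Finset V) a c.1) c.1 c.2 ∈ X'} := by
    ext c
    simp only [treeHK, hkWith, Finset.empty_union, Set.mem_setOf_eq, revealedAt_eq_revealed]
  rw [hset, Pr2W_eq_sum_ind, Finset.sum_product, ← sum_powerset_univ_eq_sum_set_csv]
  refine Finset.sum_congr rfl fun K _ => ?_
  rw [condExpV, ← sum_powerset_univ_eq_sum_set_csv p (fun η => ind X (hybrid a ↑K η)), Finset.mul_sum,
    Finset.mul_sum]
  refine Finset.sum_congr rfl fun C _ => ?_
  rw [hybrid_coe_csv]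
  have hindX : ∀ L : Finset (Sym2 V), ind X' L = ind X (↑L : Set (Sym2 V)) := fun L =>
    ind_congr_csv (by simp only [hX', Set.mem_setOf_eq])
  have hind : ind {c : Finset (Sym2 V) × Finset (Sym2 V) | c.1 ∈ X' ∧
      splice (revealedAt (Finset.univ : Finset (Sym2 V)) (∅ : Finset V) a c.1) c.1 c.2 ∈ X'} (K, C) =
      ind X' K * ind X' (splice (revealedAt (Finset.univ : Finset (Sym2 V)) (∅ : Finset V) a K) K C) := by
    by_cases h1 : K ∈ X'
    · by_cases h2 : splice (revealedAt (Finset.univ : Finset (Sym2 V)) (∅ : Finset V) a K) K C ∈ X'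
      · rw [ind_of_mem h1, ind_of_mem h2, ind_of_mem (show (K, C) ∈ {c : Finset (Sym2 V) × Finset (Sym2 V) |
          c.1 ∈ X' ∧ splice (revealedAt (Finset.univ : Finset (Sym2 V)) (∅ : Finset V) a c.1) c.1 c.2 ∈ X'}
          from ⟨h1, h2⟩)]
        norm_num
      · rw [ind_of_mem h1, ind_of_not_mem h2, ind_of_not_mem (show (K, C) ∉ {c : Finset (Sym2 V) × Finset (Sym2 V) |
          c.1 ∈ X' ∧ splice (revealedAt (Finset.univ : Finset (Sym2 V)) (∅ : Finset V) a c.1) c.1 c.2 ∈ X'}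
          from fun h => h2 h.2)]
        norm_num
    · rw [ind_of_not_mem h1, ind_of_not_mem (show (K, C) ∉ {c : Finset (Sym2 V) × Finset (Sym2 V) |
          c.1 ∈ X' ∧ splice (revealedAt (Finset.univ : Finset (Sym2 V)) (∅ : Finset V) a c.1) c.1 c.2 ∈ X'}
          from fun h => h1 h.1)]
      norm_num
  rw [hind, hindX, hindX, wt2W]
  ring

/-! ### The transfer hypothesis for the cluster exploration -/

omit [Fintype V] in
/-- **A pair at the cluster of `a` is pivotal for `{b ↔ c}` only by creating `{a ↔ b ↔ c}`.**  If `u ∈ e` is joined to `a`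
in `ω`, `b ↮ c` in `ω` and `b ↔ c` in `ω ∪ {e}`, then `a` is NOT joined to both `b, c` in `ω` and IS joined to both in
`ω ∪ {e}`. [cite: KozmaNitzan2024, Remark after Lemma 4 (one extra edge: `KNSep.reachable_insert_iff`)] -/
theorem transfer_of_reachable {ω : Set (Sym2 V)} {e : Sym2 V} {a b c u : V} (hu : u ∈ e)
    (hau : (openGraph ω).Reachable a u) (hbc : ¬ (openGraph ω).Reachable b c)
    (hbc' : (openGraph (insert e ω)).Reachable b c) :
    ¬ ((openGraph ω).Reachable a b ∧ (openGraph ω).Reachable a c) ∧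
      ((openGraph (insert e ω)).Reachable a b ∧ (openGraph (insert e ω)).Reachable a c) := by
  refine ⟨fun h => hbc (h.1.symm.trans h.2), ?_⟩
  have he : e = s(u, Sym2.Mem.other hu) := (Sym2.other_spec hu).symm
  set v := Sym2.Mem.other hu with hv
  rw [he] at hbc' ⊢
  have hmono : openGraph ω ≤ openGraph (insert s(u, v) ω) := openGraph_mono (Set.subset_insert _ _)
  have huv : (openGraph (insert s(u, v) ω)).Reachable u v := by
    by_cases h : u = v
    · rw [h]
    · exact SimpleGraph.Adj.reachable ((openGraph_adj _ u v).2 ⟨Set.mem_insert _ _, h⟩)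
  have hau' := hau.mono hmono
  rcases (KNSep.reachable_insert_iff ω u v b c).1 hbc' with h | ⟨hbu, hvc⟩ | ⟨hbv, huc⟩
  · exact absurd h hbc
  · exact ⟨hau'.trans (hbu.mono hmono).symm, hau'.trans (huv.trans (hvc.mono hmono))⟩
  · exact ⟨hau'.trans (huv.trans (hbv.mono hmono).symm), hau'.trans (huc.mono hmono)⟩

/-! ### `Var(υ) ≤ Var(1_{a ↔ b ↔ c})` in the finitary calculus -/

/-- **`E[υ²] − μ(U)² ≤ k − k²`** (`υ = E[1_{b↮c} | 𝓕(C_a)]`, `k = μ(a↔b, a↔c)`), as sums against the product weights: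
the comparison theorem `Consts.TreeCompare.Pr2W_treeHK_sub_sq_le` for the exploration of the cluster of `a`, the down-set
`{b ↮ c}` and the up-set `{a ↔ b, a ↔ c}`, plus the tower property of the hybrid.
[cite: Gladkov2024, Thm. 3.2, Lemma 3.1 and Example 2.5 (pattern); derived here] -/
theorem sum_condExpV_sq_le (w : Sym2 V → unitInterval) (a b c : V) :
    ∑ ω : Set (Sym2 V), weight (fun e => (w e : ℝ)) ω *
        condExpV (fun e => (w e : ℝ)) a (ind (openConn b c)ᶜ) ω ^ 2 ≤
      (∑ ω : Set (Sym2 V), weight (fun e => (w e : ℝ)) ω * ind (openConn b c)ᶜ ω) ^ 2 +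
        (∑ ω : Set (Sym2 V), weight (fun e => (w e : ℝ)) ω * ind (openConn a b ∩ openConn a c) ω) -
        (∑ ω : Set (Sym2 V), weight (fun e => (w e : ℝ)) ω * ind (openConn a b ∩ openConn a c) ω) ^ 2 := by
  set p : Sym2 V → ℝ := fun e => (w e : ℝ) with hp
  have hp0 : ∀ e, 0 ≤ p e := fun e => (w e).2.1
  have hp1 : ∀ e, p e ≤ 1 := fun e => (w e).2.2
  set U : Set (Set (Sym2 V)) := (openConn b c)ᶜ with hU
  set A : Set (Set (Sym2 V)) := openConn a b ∩ openConn a c with hA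
  set Uf : Set (Finset (Sym2 V)) := {K | (↑K : Set (Sym2 V)) ∈ U} with hUf
  set Af : Set (Finset (Sym2 V)) := {K | (↑K : Set (Sym2 V)) ∈ A} with hAf
  set T : DTree (Sym2 V) := ttree (Finset.univ : Finset (Sym2 V)) (∅ : Finset V)
    ((Finset.univ : Finset (Sym2 V)).card + 1) (TargetExploration.init a) with hT
  have hmemU : ∀ K : Finset (Sym2 V), K ∈ Uf ↔ ¬ (openGraph (↑K : Set (Sym2 V))).Reachable b c := fun K => by
    simp only [hUf, hU, Set.mem_setOf_eq, Set.mem_compl_iff, openConn]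
  have hmemA : ∀ K : Finset (Sym2 V), K ∈ Af ↔
      (openGraph (↑K : Set (Sym2 V))).Reachable a b ∧ (openGraph (↑K : Set (Sym2 V))).Reachable a c := fun K => by
    simp only [hAf, hA, Set.mem_setOf_eq, Set.mem_inter_iff, openConn]
  have hUlow : IsLowerSet Uf := by
    intro K K' hK'K hK
    rw [hmemU] at hK ⊢
    exact fun h => hK (h.mono (openGraph_mono (Finset.coe_subset.2 hK'K)))
  have hAup : IsUpperSet Af := by
    intro K K' hKK' hK
    rw [hmemA] at hK ⊢
    exact ⟨hK.1.mono (openGraph_mono (Finset.coe_subset.2 hKK')), hK.2.mono (openGraph_mono (Finset.coe_subset.2 hKK'))⟩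
  have hUA : ∀ K ∈ Uf, K ∉ Af := fun K hK hK' => by
    rw [hmemU] at hK; rw [hmemA] at hK'
    exact hK (hK'.1.symm.trans hK'.2)
  have hG : ∀ C : Finset (Sym2 V), ∀ e ∈ revealed T C,
      e ∉ C → C ∈ Uf → insert e C ∉ Uf → (C ∉ Af ∧ insert e C ∈ Af) := by
    intro C e he _ hCU hCe
    rw [hT, ← revealedAt_eq_revealed] at he
    obtain ⟨u, hue, hau⟩ := exists_reachable_of_mem_revealedAt he
    rw [hmemU] at hCU hCe
    rw [hmemA, hmemA, Finset.coe_insert]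
    rw [Finset.coe_insert] at hCe
    exact transfer_of_reachable hue hau hCU (not_not.1 hCe)
  have key := TreeCompare.Pr2W_treeHK_sub_sq_le Finset.univ hp0 hp1 hUlow hAup hUA T hG
  rw [hT, hUf, hAf, Pr2W_treeHK_explore_eq, Pr2W_treeHK_explore_eq, PrW_univ_eq_sum_weight,
    PrW_univ_eq_sum_weight] at key
  -- tower property: `E[1_U υ] = E[υ²]`
  have htower : ∑ ω : Set (Sym2 V), weight p ω * (ind U ω * condExpV p a (ind U) ω) =
      ∑ ω : Set (Sym2 V), weight p ω * condExpV p a (ind U) ω ^ 2 := by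
    rw [← sum_condExpV_mul p a (ind U) (condExpV p a (ind U)) (fun ω η => condExpV_hybrid p a (ind U) ω η)]
    refine Finset.sum_congr rfl fun ω _ => ?_
    rw [sq]
  -- `E[1_A υ_A] ≤ E[1_A]`
  have hsumw : ∑ η : Set (Sym2 V), weight p η = 1 := by
    have h := prodBernoulli_real_eq_sum_weight_ind w Set.univ
    simp only [probReal_univ, ind_of_mem (Set.mem_univ _), mul_one] at h
    exact h.symm
  have hcondle : ∀ ω : Set (Sym2 V), condExpV p a (ind A) ω ≤ 1 := fun ω => by
    rw [condExpV, ← hsumw]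
    exact Finset.sum_le_sum fun η _ => by
      have h0 := weight_nonneg hp0 hp1 η
      have h1 := ind_le_one A (hybrid a ω η)
      nlinarith
  have hAle : ∑ ω : Set (Sym2 V), weight p ω * (ind A ω * condExpV p a (ind A) ω) ≤
      ∑ ω : Set (Sym2 V), weight p ω * ind A ω :=
    Finset.sum_le_sum fun ω _ => mul_le_mul_of_nonneg_left
      (by
        have h0 := ind_nonneg A ω
        have h1 := hcondle ω
        nlinarith) (weight_nonneg hp0 hp1 ω)
  rw [htower] at key
  linarith

/-- **`Var(P(b ↮ c | C_a)) ≤ Var(1_{a↔b↔c})`, integral form**: `∫ υ² dμ ≤ μ(b↮c)² + k(1 − k)`, `k = μ(a↔b, a↔c)`.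
[cite: Gladkov2024, Thm. 3.2 and Example 2.5 (pattern); derived here] -/
theorem integral_condExpV_sq_le (w : Sym2 V → unitInterval) (a b c : V) :
    ∫ ω, condExpV (fun e => (w e : ℝ)) a (ind (openConn b c)ᶜ) ω ^ 2 ∂(prodBernoulli w) ≤
      (prodBernoulli w).real (openConn b c)ᶜ ^ 2 +
        (prodBernoulli w).real (openConn a b ∩ openConn a c) *
          (1 - (prodBernoulli w).real (openConn a b ∩ openConn a c)) := by
  rw [integral_prodBernoulli_eq_sum, prodBernoulli_real_eq_sum_weight_ind, prodBernoulli_real_eq_sum_weight_ind]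
  have h := sum_condExpV_sq_le w a b c
  nlinarith [h]

/-! ### `T + J ≤ E[υ²]` -/

omit [Fintype V] in
/-- The pairs meeting `{a} ∪ V(C_a)` are the pairs meeting the open vertex cluster of `a` (`ClusterConditioning.cutSet`).
[cite: VandenbergHaggstromKahn2005, §1 p. 8 (definition of `W̄`)] -/
theorem barOf_setCl_singleton_eq_cutSet (ω : Set (Sym2 V)) (a : V) :
    barOf ({a} : Set V) (setCl ω {a}) = cutSet a ω := by
  rw [BHK2006.barOf_setCl_eq]
  ext e
  simp only [Set.mem_setOf_eq, Set.mem_singleton_iff, cutSet, exists_eq_left]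

/-- **On `{a ↮ b}`, `υ = u`**: the conditional probability of `{b ↮ c}` given the cluster of `a` is the probability that
`b ↮ c` in a fresh configuration with the pairs meeting `C_a(ω)` deleted.
[cite: VandenbergHaggstromKahn2005, §1 p. 8 and §2.1 Lemma 2.4 (the configuration off the cluster is fresh)] -/
theorem condExpV_notConn_eq_of_not_reachable (w : Sym2 V → unitInterval) {a b : V} (c : V) {ω : Set (Sym2 V)}
    (hab : ¬ (openGraph ω).Reachable a b) :
    condExpV (fun e => (w e : ℝ)) a (ind (openConn b c)ᶜ) ω =
      (prodBernoulli w).real {η | ¬ (openGraph (η \ barOf {a} (setCl ω {a}))).Reachable b c} := by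
  rw [prodBernoulli_real_eq_sum_weight_ind, condExpV]
  refine Finset.sum_congr rfl fun η _ => ?_
  rw [ind_congr_csv (X := (openConn b c)ᶜ) (Y := {η : Set (Sym2 V) | ¬ (openGraph (η \ barOf {a} (setCl ω {a}))).Reachable b c})
    (x := hybrid a ω η) (y := η) ?_]
  rw [Set.mem_compl_iff, openConn, Set.mem_setOf_eq, Set.mem_setOf_eq, reachable_hybrid_iff_diff_cutSet hab η c,
    barOf_setCl_singleton_eq_cutSet]

/-- **On "exactly one of `b, c` in `C_a`", `υ = 1`**: every hybrid keeps the cluster of `a`, so `b ↮ c` in all of them.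
[cite: Gladkov2024, Lemma 3.1 (S(C₁ →_S C₂) = S(C₁))] -/
theorem condExpV_notConn_eq_one_of_xor (w : Sym2 V → unitInterval) {a b c : V} {ω : Set (Sym2 V)}
    (h : ((openGraph ω).Reachable a b ∧ ¬ (openGraph ω).Reachable a c) ∨
      ((openGraph ω).Reachable a c ∧ ¬ (openGraph ω).Reachable a b)) :
    condExpV (fun e => (w e : ℝ)) a (ind (openConn b c)ᶜ) ω = 1 := by
  have hsumw : ∑ η : Set (Sym2 V), weight (fun e => (w e : ℝ)) η = 1 := by
    have h := prodBernoulli_real_eq_sum_weight_ind w Set.univ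
    simp only [probReal_univ, ind_of_mem (Set.mem_univ _), mul_one] at h
    exact h.symm
  rw [condExpV, ← hsumw]
  refine Finset.sum_congr rfl fun η _ => ?_
  have hmem : hybrid a ω η ∈ (openConn b c)ᶜ := by
    rw [Set.mem_compl_iff, openConn, Set.mem_setOf_eq]
    intro hbc
    rcases h with ⟨hab, hac⟩ | ⟨hac, hab⟩
    · exact hac ((reachable_hybrid_iff' a ω η c).1 (((reachable_hybrid_iff' a ω η b).2 hab).trans hbc))
    · exact hab ((reachable_hybrid_iff' a ω η b).1 (((reachable_hybrid_iff' a ω η c).2 hac).trans hbc.symm))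
  rw [ind_of_mem hmem, mul_one]

/-- `∫_S g dμ = Σ_ω weight(ω) g(ω) 1_S(ω)`. [folklore] -/
private theorem setIntegral_eq_sum_csv (w : Sym2 V → unitInterval) (S : Set (Set (Sym2 V))) (g : Set (Sym2 V) → ℝ) :
    ∫ ω in S, g ω ∂(prodBernoulli w) = ∑ ω : Set (Sym2 V), weight (fun e => (w e : ℝ)) ω * (g ω * ind S ω) := by
  rw [← integral_indicator MeasurableSet.of_discrete, integral_prodBernoulli_eq_sum]
  refine Finset.sum_congr rfl fun ω _ => ?_
  by_cases hω : ω ∈ S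
  · rw [Set.indicator_of_mem hω, ind_of_mem hω, mul_one]
  · rw [Set.indicator_of_notMem hω, ind_of_not_mem hω]; simp

/-- **`T + J ≤ E[υ²]`**: the cluster square plus the probability that `a` is joined to exactly one of `b, c` is at most
`∫ υ² dμ` (in fact equal). [cite: VandenbergHaggstromKahn2005, §2.1 Lemma 2.4 (conditioning on the cluster of a)] -/
theorem clusterSquare_add_real_xor_le_integral_condExpV_sq (w : Sym2 V → unitInterval) (a b c : V) :
    (∫ ω in (openConn a b)ᶜ ∩ (openConn a c)ᶜ,
        (prodBernoulli w).real {η | ¬ (openGraph (η \ barOf {a} (setCl ω {a}))).Reachable b c} ^ 2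
          ∂(prodBernoulli w)) +
      (prodBernoulli w).real ((openConn a b ∪ openConn a c) \ (openConn a b ∩ openConn a c)) ≤
    ∫ ω, condExpV (fun e => (w e : ℝ)) a (ind (openConn b c)ᶜ) ω ^ 2 ∂(prodBernoulli w) := by
  set p : Sym2 V → ℝ := fun e => (w e : ℝ) with hp
  have hp0 : ∀ e, 0 ≤ p e := fun e => (w e).2.1
  have hp1 : ∀ e, p e ≤ 1 := fun e => (w e).2.2
  set Dset : Set (Set (Sym2 V)) := (openConn a b)ᶜ ∩ (openConn a c)ᶜ with hD
  set Jset : Set (Set (Sym2 V)) := (openConn a b ∪ openConn a c) \ (openConn a b ∩ openConn a c) with hJ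
  rw [setIntegral_eq_sum_csv, prodBernoulli_real_eq_sum_weight_ind, integral_prodBernoulli_eq_sum,
    ← Finset.sum_add_distrib]
  refine Finset.sum_le_sum fun ω _ => ?_
  rw [← mul_add]
  refine mul_le_mul_of_nonneg_left ?_ (weight_nonneg hp0 hp1 ω)
  by_cases hab : (openGraph ω).Reachable a b
  · -- `a ↔ b`: `ω ∉ D_a`
    have hωD : ω ∉ Dset := fun h => h.1 hab
    rw [ind_of_not_mem hωD, mul_zero, zero_add]
    by_cases hac : (openGraph ω).Reachable a c
    · have hωJ : ω ∉ Jset := fun h => h.2 ⟨hab, hac⟩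
      rw [ind_of_not_mem hωJ]; exact sq_nonneg _
    · rw [condExpV_notConn_eq_one_of_xor w (Or.inl ⟨hab, hac⟩)]
      have := ind_le_one Jset ω
      nlinarith
  · by_cases hac : (openGraph ω).Reachable a c
    · have hωD : ω ∉ Dset := fun h => h.2 hac
      rw [ind_of_not_mem hωD, mul_zero, zero_add, condExpV_notConn_eq_one_of_xor w (Or.inr ⟨hac, hab⟩)]
      have := ind_le_one Jset ω
      nlinarith
    · -- `ω ∈ D_a`: `υ = u`
      have hωD : ω ∈ Dset := ⟨hab, hac⟩
      have hωJ : ω ∉ Jset := fun h => by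
        rcases h.1 with h1 | h1
        · exact hab h1
        · exact hac h1
      rw [ind_of_mem hωD, ind_of_not_mem hωJ, mul_one, add_zero, condExpV_notConn_eq_of_not_reachable w c hab]

end General

/-! ### The partial cluster-square inequality and the rooted split inequality for small triple connection -/

/-- **THE PARTIAL CLUSTER-SQUARE INEQUALITY** (`Var(P(b↮c | C_a)) ≤ Var(1_{a↔b↔c})` in the language of gen 15):
`T ≤ μ(b ↮ c)² − J + k(1 − k)`, where `T = Consts.clusterSquare w a b c`, `J = μ(a joined to exactly one of b, c)` and
`k = μ(a ↔ b, a ↔ c)`.  (The conjecture `Consts.ClusterSquareSplit` is `T ≤ μ(b↮c)²`.)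
[cite: Gladkov2024, Thm. 3.2 and Example 2.5 (pattern); VandenbergHaggstromKahn2005, Lemma 2.4; derived here] -/
theorem clusterSquare_le_sq_sub_xor_add {n : ℕ} (w : Sym2 (Fin n) → unitInterval) (a b c : Fin n) :
    clusterSquare w a b c ≤
      (prodBernoulli w).real (openConn b c)ᶜ ^ 2 -
        (prodBernoulli w).real ((openConn a b ∪ openConn a c) \ (openConn a b ∩ openConn a c)) +
        (prodBernoulli w).real (openConn a b ∩ openConn a c) *
          (1 - (prodBernoulli w).real (openConn a b ∩ openConn a c)) := by
  have h1 := integral_condExpV_sq_le w a b c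
  have h2 := clusterSquare_add_real_xor_le_integral_condExpV_sq w a b c
  have h3 : clusterSquare w a b c = ∫ ω in (openConn a b)ᶜ ∩ (openConn a c)ᶜ,
      (prodBernoulli w).real {η | ¬ (openGraph (η \ barOf {a} (setCl ω {a}))).Reachable b c} ^ 2
        ∂(prodBernoulli w) := rfl
  linarith

/-- **The rooted split inequality (DUU) for triples with small triple connection**: if
`μ(a↔b↔c) · (1 − μ(a↔b↔c)) ≤ μ(a joined to exactly one of b, c)` then `μ(a|b|c)² ≤ μ(a ↮ b, a ↮ c) · μ(b ↮ c)²`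
(the body of `Consts.RootedSplit` at this triple; by the kernel Cauchy–Schwarz step of gen 15 and the partial cluster-square
inequality). [cite: Gladkov2024, Thm. 5.2 / Cor. 5.3 (the two-step pattern); derived here] -/
theorem sq_real_split_le_of_small_triple {n : ℕ} (w : Sym2 (Fin n) → unitInterval) (a b c : Fin n)
    (hk : (prodBernoulli w).real (openConn a b ∩ openConn a c) *
        (1 - (prodBernoulli w).real (openConn a b ∩ openConn a c)) ≤
      (prodBernoulli w).real ((openConn a b ∪ openConn a c) \ (openConn a b ∩ openConn a c))) :
    (prodBernoulli w).real ((openConn a b)ᶜ ∩ (openConn a c)ᶜ ∩ (openConn b c)ᶜ) ^ 2 ≤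
      (prodBernoulli w).real ((openConn a b)ᶜ ∩ (openConn a c)ᶜ) * (prodBernoulli w).real (openConn b c)ᶜ ^ 2 := by
  have h1 := sq_real_split_le_real_mul_clusterSquare w a b c
  have h2 := clusterSquare_le_sq_sub_xor_add w a b c
  have h3 : clusterSquare w a b c ≤ (prodBernoulli w).real (openConn b c)ᶜ ^ 2 := by linarith
  exact h1.trans (mul_le_mul_of_nonneg_left h3 measureReal_nonneg)

end Consts

end Summit.CriticalPhenomena.PercolationContinuityZ3.Theorems
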